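import Summits.CriticalPhenomena.SAWScalingLimit.Theorems.SAWTotalPositivityBoundaryTP2Strip4EndB
import Summits.CriticalPhenomena.SAWScalingLimit.Theorems.SAWTotalPositivityBoundaryTP2Strip4Tail
import Summits.CriticalPhenomena.SAWScalingLimit.Theorems.SAWTotalPositivityBoundaryTP2Strip4Corner
import HarnessLib

/-!
# Crux `BoundaryTP2` (stmt-CriticalPhenomena-7115), line `Sketch`: END-PAIR labelling on the 4-row strips, part C — lengths
`3 ≤ n ≤ 6` (direct checks against `S_3 ≤ S_n`), the tail `n ≥ 7` (entrywise bounds, certified non-increase, tail check), and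
`strip4_endForms_real` for every `n ≥ 1` (lead c6) [folklore]
-/

noncomputable section

namespace Summit.CriticalPhenomena.SAWScalingLimit.Theorems.BoundaryTP2

open Literature.Probability.LatticeModels Literature.Probability.RandomPlanarGeometry
open Summit.CriticalPhenomena.SAWScalingLimit.Theorems.EdgeOfPositivity.Negative
open Summit.CriticalPhenomena.SAWScalingLimit.Theorems.BoundaryTP2.Negative.Cert
open Summit.CriticalPhenomena.SAWScalingLimit.Theorems.BoundaryTP2.StripCert
open scoped ENNReal

set_option linter.unusedSimpArgs false in
/-- The thirteen end-pair forms at lengths `3..6` (end kernels of `S_3 ≤ S_n`). [folklore] -/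
theorem strip4_endForms_head3 (n : ℕ) (h3 : 3 ≤ n) (h7 : n < 7) {x : ℝ} (hx1 : 1 / 3 ≤ x) (hx2 : x ≤ 5 / 13) :
    (pathKernel (discreteDomainGraph (rectDomain n 3) 1) x (st 0 0) (st n 1)).toReal * (pathKernel (discreteDomainGraph (rectDomain n 3) 1) x (st 0 0) (st n 1)).toReal ≤
      (pathKernel (discreteDomainGraph (rectDomain n 3) 1) x (st 0 0) (st 0 1)).toReal * (pathKernel (discreteDomainGraph (rectDomain n 3) 1) x (st 0 0) (st 0 1)).toReal ∧
    (pathKernel (discreteDomainGraph (rectDomain n 3) 1) x (st 0 0) (st n 1)).toReal * (pathKernel (discreteDomainGraph (rectDomain n 3) 1) x (st 0 0) (st n 2)).toReal ≤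
      (pathKernel (discreteDomainGraph (rectDomain n 3) 1) x (st 0 0) (st 0 1)).toReal * (pathKernel (discreteDomainGraph (rectDomain n 3) 1) x (st 0 0) (st 0 2)).toReal ∧
    (pathKernel (discreteDomainGraph (rectDomain n 3) 1) x (st 0 0) (st n 1)).toReal * (pathKernel (discreteDomainGraph (rectDomain n 3) 1) x (st 0 0) (st n 3)).toReal ≤
      (pathKernel (discreteDomainGraph (rectDomain n 3) 1) x (st 0 0) (st 0 1)).toReal * (pathKernel (discreteDomainGraph (rectDomain n 3) 1) x (st 0 0) (st 0 3)).toReal ∧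
    (pathKernel (discreteDomainGraph (rectDomain n 3) 1) x (st 0 0) (st n 2)).toReal * (pathKernel (discreteDomainGraph (rectDomain n 3) 1) x (st 0 1) (st n 1)).toReal ≤
      (pathKernel (discreteDomainGraph (rectDomain n 3) 1) x (st 0 0) (st 0 1)).toReal * (pathKernel (discreteDomainGraph (rectDomain n 3) 1) x (st 0 1) (st 0 2)).toReal ∧
    (pathKernel (discreteDomainGraph (rectDomain n 3) 1) x (st 0 0) (st n 3)).toReal * (pathKernel (discreteDomainGraph (rectDomain n 3) 1) x (st 0 1) (st n 1)).toReal ≤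
      (pathKernel (discreteDomainGraph (rectDomain n 3) 1) x (st 0 0) (st 0 1)).toReal * (pathKernel (discreteDomainGraph (rectDomain n 3) 1) x (st 0 0) (st 0 2)).toReal ∧
    (pathKernel (discreteDomainGraph (rectDomain n 3) 1) x (st 0 0) (st n 3)).toReal * (pathKernel (discreteDomainGraph (rectDomain n 3) 1) x (st 0 1) (st n 2)).toReal ≤
      (pathKernel (discreteDomainGraph (rectDomain n 3) 1) x (st 0 0) (st 0 1)).toReal * (pathKernel (discreteDomainGraph (rectDomain n 3) 1) x (st 0 0) (st 0 1)).toReal ∧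
    (pathKernel (discreteDomainGraph (rectDomain n 3) 1) x (st 0 0) (st n 2)).toReal * (pathKernel (discreteDomainGraph (rectDomain n 3) 1) x (st 0 0) (st n 2)).toReal ≤
      (pathKernel (discreteDomainGraph (rectDomain n 3) 1) x (st 0 0) (st 0 2)).toReal * (pathKernel (discreteDomainGraph (rectDomain n 3) 1) x (st 0 0) (st 0 2)).toReal ∧
    (pathKernel (discreteDomainGraph (rectDomain n 3) 1) x (st 0 0) (st n 2)).toReal * (pathKernel (discreteDomainGraph (rectDomain n 3) 1) x (st 0 0) (st n 3)).toReal ≤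
      (pathKernel (discreteDomainGraph (rectDomain n 3) 1) x (st 0 0) (st 0 2)).toReal * (pathKernel (discreteDomainGraph (rectDomain n 3) 1) x (st 0 0) (st 0 3)).toReal ∧
    (pathKernel (discreteDomainGraph (rectDomain n 3) 1) x (st 0 0) (st n 2)).toReal * (pathKernel (discreteDomainGraph (rectDomain n 3) 1) x (st 0 1) (st n 2)).toReal ≤
      (pathKernel (discreteDomainGraph (rectDomain n 3) 1) x (st 0 0) (st 0 2)).toReal * (pathKernel (discreteDomainGraph (rectDomain n 3) 1) x (st 0 1) (st 0 2)).toReal ∧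
    (pathKernel (discreteDomainGraph (rectDomain n 3) 1) x (st 0 0) (st n 3)).toReal * (pathKernel (discreteDomainGraph (rectDomain n 3) 1) x (st 0 1) (st n 2)).toReal ≤
      (pathKernel (discreteDomainGraph (rectDomain n 3) 1) x (st 0 0) (st 0 2)).toReal * (pathKernel (discreteDomainGraph (rectDomain n 3) 1) x (st 0 0) (st 0 2)).toReal ∧
    (pathKernel (discreteDomainGraph (rectDomain n 3) 1) x (st 0 0) (st n 3)).toReal * (pathKernel (discreteDomainGraph (rectDomain n 3) 1) x (st 0 0) (st n 3)).toReal ≤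
      (pathKernel (discreteDomainGraph (rectDomain n 3) 1) x (st 0 0) (st 0 3)).toReal * (pathKernel (discreteDomainGraph (rectDomain n 3) 1) x (st 0 0) (st 0 3)).toReal ∧
    (pathKernel (discreteDomainGraph (rectDomain n 3) 1) x (st 0 0) (st n 2)).toReal * (pathKernel (discreteDomainGraph (rectDomain n 3) 1) x (st 0 0) (st n 2)).toReal ≤
      (pathKernel (discreteDomainGraph (rectDomain n 3) 1) x (st 0 0) (st 0 3)).toReal * (pathKernel (discreteDomainGraph (rectDomain n 3) 1) x (st 0 1) (st 0 2)).toReal ∧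
    (pathKernel (discreteDomainGraph (rectDomain n 3) 1) x (st 0 1) (st n 2)).toReal * (pathKernel (discreteDomainGraph (rectDomain n 3) 1) x (st 0 1) (st n 2)).toReal ≤
      (pathKernel (discreteDomainGraph (rectDomain n 3) 1) x (st 0 1) (st 0 2)).toReal * (pathKernel (discreteDomainGraph (rectDomain n 3) 1) x (st 0 1) (st 0 2)).toReal := by
  have hx0 : 0 ≤ x := by linarith
  obtain ⟨t10, t20, t30, t13, t21, t22, t23, t31, t32, t33⟩ := strip4_table n x
  obtain ⟨Up, hUp0, hUp, hUpd⟩ := strip4_evenTraj hx0 0 3 (Or.inl ⟨rfl, rfl⟩)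
  obtain ⟨Wp, hWp0, hWp, hWpd⟩ := strip4_evenTraj hx0 1 2 (Or.inr ⟨rfl, rfl⟩)
  obtain ⟨Uo, hUo0, hUo, hUod⟩ := strip4_oddTraj hx0 0 3 (Or.inl ⟨rfl, rfl⟩)
  obtain ⟨Wo, hWo0, hWo, hWod⟩ := strip4_oddTraj hx0 1 2 (Or.inr ⟨rfl, rfl⟩)
  simp only [if_pos] at hUp0 hUo0
  rw [if_neg (by norm_num)] at hWp0 hWo0
  -- letters
  have Lb : Up n 1 + Uo n 1 = 2 * (pathKernel (discreteDomainGraph (rectDomain n 3) 1) x (st 0 0) (st n 1)).toReal := by rw [(hUpd n).2, (hUod n).2, t31]; ring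
  have Lc : Up n 1 - Uo n 1 = 2 * (pathKernel (discreteDomainGraph (rectDomain n 3) 1) x (st 0 0) (st n 2)).toReal := by rw [(hUpd n).2, (hUod n).2, t31]; ring
  have Ld : Up n 0 - Uo n 0 = 2 * (pathKernel (discreteDomainGraph (rectDomain n 3) 1) x (st 0 0) (st n 3)).toReal := by rw [(hUpd n).1, (hUod n).1, t30]; ring
  have Le : Wp n 1 + Wo n 1 = 2 * (pathKernel (discreteDomainGraph (rectDomain n 3) 1) x (st 0 1) (st n 1)).toReal := by rw [(hWpd n).2, (hWod n).2, t21]; ring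
  have Lf : Wp n 1 - Wo n 1 = 2 * (pathKernel (discreteDomainGraph (rectDomain n 3) 1) x (st 0 1) (st n 2)).toReal := by rw [(hWpd n).2, (hWod n).2, t21]; ring
  have eU := traj_eq_evV_iterMV TeData 6 x ue0 hUp0 hUp n
  have eW := traj_eq_evV_iterMV TeData 6 x we0 hWp0 hWp n
  have eUo := traj_eq_evV_iterMV ToData 6 x uo0 hUo0 hUo n
  have eWo := traj_eq_evV_iterMV ToData 6 x wo0 hWo0 hWo n
  have c := fun q (hq : q < 13) => evZ_nonneg_on_enclosure (by norm_num) (cert_end3 n h3 h7 q hq) hx1 hx2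
  obtain ⟨s0, s1, s2, s3, s4, s5, s6, s7, s8, s9, s10, s11, s12⟩ := evZ_endPolys3 n x
  have c0 := c 0 (by norm_num)
  simp only [s0, ← eU 1 (by norm_num), ← eU 0 (by norm_num), ← eW 1 (by norm_num), ← eUo 1 (by norm_num),
    ← eUo 0 (by norm_num), ← eWo 1 (by norm_num), Lb, Lc, Ld, Le, Lf] at c0
  have c1 := c 1 (by norm_num)
  simp only [s1, ← eU 1 (by norm_num), ← eU 0 (by norm_num), ← eW 1 (by norm_num), ← eUo 1 (by norm_num),
    ← eUo 0 (by norm_num), ← eWo 1 (by norm_num), Lb, Lc, Ld, Le, Lf] at c1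
  have c2 := c 2 (by norm_num)
  simp only [s2, ← eU 1 (by norm_num), ← eU 0 (by norm_num), ← eW 1 (by norm_num), ← eUo 1 (by norm_num),
    ← eUo 0 (by norm_num), ← eWo 1 (by norm_num), Lb, Lc, Ld, Le, Lf] at c2
  have c3 := c 3 (by norm_num)
  simp only [s3, ← eU 1 (by norm_num), ← eU 0 (by norm_num), ← eW 1 (by norm_num), ← eUo 1 (by norm_num),
    ← eUo 0 (by norm_num), ← eWo 1 (by norm_num), Lb, Lc, Ld, Le, Lf] at c3
  have c4 := c 4 (by norm_num)
  simp only [s4, ← eU 1 (by norm_num), ← eU 0 (by norm_num), ← eW 1 (by norm_num), ← eUo 1 (by norm_num),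
    ← eUo 0 (by norm_num), ← eWo 1 (by norm_num), Lb, Lc, Ld, Le, Lf] at c4
  have c5 := c 5 (by norm_num)
  simp only [s5, ← eU 1 (by norm_num), ← eU 0 (by norm_num), ← eW 1 (by norm_num), ← eUo 1 (by norm_num),
    ← eUo 0 (by norm_num), ← eWo 1 (by norm_num), Lb, Lc, Ld, Le, Lf] at c5
  have c6 := c 6 (by norm_num)
  simp only [s6, ← eU 1 (by norm_num), ← eU 0 (by norm_num), ← eW 1 (by norm_num), ← eUo 1 (by norm_num),
    ← eUo 0 (by norm_num), ← eWo 1 (by norm_num), Lb, Lc, Ld, Le, Lf] at c6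
  have c7 := c 7 (by norm_num)
  simp only [s7, ← eU 1 (by norm_num), ← eU 0 (by norm_num), ← eW 1 (by norm_num), ← eUo 1 (by norm_num),
    ← eUo 0 (by norm_num), ← eWo 1 (by norm_num), Lb, Lc, Ld, Le, Lf] at c7
  have c8 := c 8 (by norm_num)
  simp only [s8, ← eU 1 (by norm_num), ← eU 0 (by norm_num), ← eW 1 (by norm_num), ← eUo 1 (by norm_num),
    ← eUo 0 (by norm_num), ← eWo 1 (by norm_num), Lb, Lc, Ld, Le, Lf] at c8
  have c9 := c 9 (by norm_num)
  simp only [s9, ← eU 1 (by norm_num), ← eU 0 (by norm_num), ← eW 1 (by norm_num), ← eUo 1 (by norm_num),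
    ← eUo 0 (by norm_num), ← eWo 1 (by norm_num), Lb, Lc, Ld, Le, Lf] at c9
  have c10 := c 10 (by norm_num)
  simp only [s10, ← eU 1 (by norm_num), ← eU 0 (by norm_num), ← eW 1 (by norm_num), ← eUo 1 (by norm_num),
    ← eUo 0 (by norm_num), ← eWo 1 (by norm_num), Lb, Lc, Ld, Le, Lf] at c10
  have c11 := c 11 (by norm_num)
  simp only [s11, ← eU 1 (by norm_num), ← eU 0 (by norm_num), ← eW 1 (by norm_num), ← eUo 1 (by norm_num),
    ← eUo 0 (by norm_num), ← eWo 1 (by norm_num), Lb, Lc, Ld, Le, Lf] at c11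
  have c12 := c 12 (by norm_num)
  simp only [s12, ← eU 1 (by norm_num), ← eU 0 (by norm_num), ← eW 1 (by norm_num), ← eUo 1 (by norm_num),
    ← eUo 0 (by norm_num), ← eWo 1 (by norm_num), Lb, Lc, Ld, Le, Lf] at c12
  -- the table values are (below) the end kernels at length n
  have v01 := toReal_end_of_table (m := 3) (j := 0) (k := 1) (by norm_num) hx0 E3_01_eq
  have e01 : 0 ≤ evZ E3_01 x := by rw [← v01]; exact ENNReal.toReal_nonneg
  have h01 : evZ E3_01 x ≤ (pathKernel (discreteDomainGraph (rectDomain n 3) 1) x (st 0 0) (st 0 1)).toReal := by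
    rw [← v01]
    exact (ENNReal.toReal_le_toReal (strip4_ne_top 3 x _ _) (strip4_ne_top n x _ _)).2
      (pathKernel_mono (strip4_graph_mono h3) x _ _)
  have v02 := toReal_end_of_table (m := 3) (j := 0) (k := 2) (by norm_num) hx0 E3_02_eq
  have e02 : 0 ≤ evZ E3_02 x := by rw [← v02]; exact ENNReal.toReal_nonneg
  have h02 : evZ E3_02 x ≤ (pathKernel (discreteDomainGraph (rectDomain n 3) 1) x (st 0 0) (st 0 2)).toReal := by
    rw [← v02]
    exact (ENNReal.toReal_le_toReal (strip4_ne_top 3 x _ _) (strip4_ne_top n x _ _)).2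
      (pathKernel_mono (strip4_graph_mono h3) x _ _)
  have v03 := toReal_end_of_table (m := 3) (j := 0) (k := 3) (by norm_num) hx0 E3_03_eq
  have e03 : 0 ≤ evZ E3_03 x := by rw [← v03]; exact ENNReal.toReal_nonneg
  have h03 : evZ E3_03 x ≤ (pathKernel (discreteDomainGraph (rectDomain n 3) 1) x (st 0 0) (st 0 3)).toReal := by
    rw [← v03]
    exact (ENNReal.toReal_le_toReal (strip4_ne_top 3 x _ _) (strip4_ne_top n x _ _)).2
      (pathKernel_mono (strip4_graph_mono h3) x _ _)
  have v12 := toReal_end_of_table (m := 3) (j := 1) (k := 2) (by norm_num) hx0 E3_12_eq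
  have e12 : 0 ≤ evZ E3_12 x := by rw [← v12]; exact ENNReal.toReal_nonneg
  have h12 : evZ E3_12 x ≤ (pathKernel (discreteDomainGraph (rectDomain n 3) 1) x (st 0 1) (st 0 2)).toReal := by
    rw [← v12]
    exact (ENNReal.toReal_le_toReal (strip4_ne_top 3 x _ _) (strip4_ne_top n x _ _)).2
      (pathKernel_mono (strip4_graph_mono h3) x _ _)

  exact endForms_of_certs e01 e02 e03 e12 h01 h02 h03 h12 c0 c1 c2 c3 c4 c5 c6 c7 c8 c9 c10 c11 c12

/-- The thirteen end-pair forms at lengths `n ≥ 7` (entrywise bounds, certified non-increase, tail check). [folklore] -/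
theorem strip4_endForms_tail (n : ℕ) (h7 : 7 ≤ n) {x : ℝ} (hx1 : 1 / 3 ≤ x) (hx2 : x ≤ 5 / 13) :
    (pathKernel (discreteDomainGraph (rectDomain n 3) 1) x (st 0 0) (st n 1)).toReal * (pathKernel (discreteDomainGraph (rectDomain n 3) 1) x (st 0 0) (st n 1)).toReal ≤
      (pathKernel (discreteDomainGraph (rectDomain n 3) 1) x (st 0 0) (st 0 1)).toReal * (pathKernel (discreteDomainGraph (rectDomain n 3) 1) x (st 0 0) (st 0 1)).toReal ∧
    (pathKernel (discreteDomainGraph (rectDomain n 3) 1) x (st 0 0) (st n 1)).toReal * (pathKernel (discreteDomainGraph (rectDomain n 3) 1) x (st 0 0) (st n 2)).toReal ≤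
      (pathKernel (discreteDomainGraph (rectDomain n 3) 1) x (st 0 0) (st 0 1)).toReal * (pathKernel (discreteDomainGraph (rectDomain n 3) 1) x (st 0 0) (st 0 2)).toReal ∧
    (pathKernel (discreteDomainGraph (rectDomain n 3) 1) x (st 0 0) (st n 1)).toReal * (pathKernel (discreteDomainGraph (rectDomain n 3) 1) x (st 0 0) (st n 3)).toReal ≤
      (pathKernel (discreteDomainGraph (rectDomain n 3) 1) x (st 0 0) (st 0 1)).toReal * (pathKernel (discreteDomainGraph (rectDomain n 3) 1) x (st 0 0) (st 0 3)).toReal ∧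
    (pathKernel (discreteDomainGraph (rectDomain n 3) 1) x (st 0 0) (st n 2)).toReal * (pathKernel (discreteDomainGraph (rectDomain n 3) 1) x (st 0 1) (st n 1)).toReal ≤
      (pathKernel (discreteDomainGraph (rectDomain n 3) 1) x (st 0 0) (st 0 1)).toReal * (pathKernel (discreteDomainGraph (rectDomain n 3) 1) x (st 0 1) (st 0 2)).toReal ∧
    (pathKernel (discreteDomainGraph (rectDomain n 3) 1) x (st 0 0) (st n 3)).toReal * (pathKernel (discreteDomainGraph (rectDomain n 3) 1) x (st 0 1) (st n 1)).toReal ≤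
      (pathKernel (discreteDomainGraph (rectDomain n 3) 1) x (st 0 0) (st 0 1)).toReal * (pathKernel (discreteDomainGraph (rectDomain n 3) 1) x (st 0 0) (st 0 2)).toReal ∧
    (pathKernel (discreteDomainGraph (rectDomain n 3) 1) x (st 0 0) (st n 3)).toReal * (pathKernel (discreteDomainGraph (rectDomain n 3) 1) x (st 0 1) (st n 2)).toReal ≤
      (pathKernel (discreteDomainGraph (rectDomain n 3) 1) x (st 0 0) (st 0 1)).toReal * (pathKernel (discreteDomainGraph (rectDomain n 3) 1) x (st 0 0) (st 0 1)).toReal ∧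
    (pathKernel (discreteDomainGraph (rectDomain n 3) 1) x (st 0 0) (st n 2)).toReal * (pathKernel (discreteDomainGraph (rectDomain n 3) 1) x (st 0 0) (st n 2)).toReal ≤
      (pathKernel (discreteDomainGraph (rectDomain n 3) 1) x (st 0 0) (st 0 2)).toReal * (pathKernel (discreteDomainGraph (rectDomain n 3) 1) x (st 0 0) (st 0 2)).toReal ∧
    (pathKernel (discreteDomainGraph (rectDomain n 3) 1) x (st 0 0) (st n 2)).toReal * (pathKernel (discreteDomainGraph (rectDomain n 3) 1) x (st 0 0) (st n 3)).toReal ≤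
      (pathKernel (discreteDomainGraph (rectDomain n 3) 1) x (st 0 0) (st 0 2)).toReal * (pathKernel (discreteDomainGraph (rectDomain n 3) 1) x (st 0 0) (st 0 3)).toReal ∧
    (pathKernel (discreteDomainGraph (rectDomain n 3) 1) x (st 0 0) (st n 2)).toReal * (pathKernel (discreteDomainGraph (rectDomain n 3) 1) x (st 0 1) (st n 2)).toReal ≤
      (pathKernel (discreteDomainGraph (rectDomain n 3) 1) x (st 0 0) (st 0 2)).toReal * (pathKernel (discreteDomainGraph (rectDomain n 3) 1) x (st 0 1) (st 0 2)).toReal ∧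
    (pathKernel (discreteDomainGraph (rectDomain n 3) 1) x (st 0 0) (st n 3)).toReal * (pathKernel (discreteDomainGraph (rectDomain n 3) 1) x (st 0 1) (st n 2)).toReal ≤
      (pathKernel (discreteDomainGraph (rectDomain n 3) 1) x (st 0 0) (st 0 2)).toReal * (pathKernel (discreteDomainGraph (rectDomain n 3) 1) x (st 0 0) (st 0 2)).toReal ∧
    (pathKernel (discreteDomainGraph (rectDomain n 3) 1) x (st 0 0) (st n 3)).toReal * (pathKernel (discreteDomainGraph (rectDomain n 3) 1) x (st 0 0) (st n 3)).toReal ≤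
      (pathKernel (discreteDomainGraph (rectDomain n 3) 1) x (st 0 0) (st 0 3)).toReal * (pathKernel (discreteDomainGraph (rectDomain n 3) 1) x (st 0 0) (st 0 3)).toReal ∧
    (pathKernel (discreteDomainGraph (rectDomain n 3) 1) x (st 0 0) (st n 2)).toReal * (pathKernel (discreteDomainGraph (rectDomain n 3) 1) x (st 0 0) (st n 2)).toReal ≤
      (pathKernel (discreteDomainGraph (rectDomain n 3) 1) x (st 0 0) (st 0 3)).toReal * (pathKernel (discreteDomainGraph (rectDomain n 3) 1) x (st 0 1) (st 0 2)).toReal ∧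
    (pathKernel (discreteDomainGraph (rectDomain n 3) 1) x (st 0 1) (st n 2)).toReal * (pathKernel (discreteDomainGraph (rectDomain n 3) 1) x (st 0 1) (st n 2)).toReal ≤
      (pathKernel (discreteDomainGraph (rectDomain n 3) 1) x (st 0 1) (st 0 2)).toReal * (pathKernel (discreteDomainGraph (rectDomain n 3) 1) x (st 0 1) (st 0 2)).toReal := by
  have hx0 : 0 ≤ x := by linarith
  obtain ⟨t10, t20, t30, t13, t21, t22, t23, t31, t32, t33⟩ := strip4_table n x
  obtain ⟨Up, hUp0, hUp, hUpd⟩ := strip4_evenTraj hx0 0 3 (Or.inl ⟨rfl, rfl⟩)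
  obtain ⟨Wp, hWp0, hWp, hWpd⟩ := strip4_evenTraj hx0 1 2 (Or.inr ⟨rfl, rfl⟩)
  obtain ⟨Uo, hUo0, hUo, hUod⟩ := strip4_oddTraj hx0 0 3 (Or.inl ⟨rfl, rfl⟩)
  obtain ⟨Wo, hWo0, hWo, hWod⟩ := strip4_oddTraj hx0 1 2 (Or.inr ⟨rfl, rfl⟩)
  simp only [if_pos] at hUp0 hUo0
  rw [if_neg (by norm_num)] at hWp0 hWo0
  -- letters
  have Lb : Up n 1 + Uo n 1 = 2 * (pathKernel (discreteDomainGraph (rectDomain n 3) 1) x (st 0 0) (st n 1)).toReal := by rw [(hUpd n).2, (hUod n).2, t31]; ring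
  have Lc : Up n 1 - Uo n 1 = 2 * (pathKernel (discreteDomainGraph (rectDomain n 3) 1) x (st 0 0) (st n 2)).toReal := by rw [(hUpd n).2, (hUod n).2, t31]; ring
  have Ld : Up n 0 - Uo n 0 = 2 * (pathKernel (discreteDomainGraph (rectDomain n 3) 1) x (st 0 0) (st n 3)).toReal := by rw [(hUpd n).1, (hUod n).1, t30]; ring
  have Le : Wp n 1 + Wo n 1 = 2 * (pathKernel (discreteDomainGraph (rectDomain n 3) 1) x (st 0 1) (st n 1)).toReal := by rw [(hWpd n).2, (hWod n).2, t21]; ring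
  have Lf : Wp n 1 - Wo n 1 = 2 * (pathKernel (discreteDomainGraph (rectDomain n 3) 1) x (st 0 1) (st n 2)).toReal := by rw [(hWpd n).2, (hWod n).2, t21]; ring
  have eU := traj_eq_evV_iterMV TeData 6 x ue0 hUp0 hUp n
  have eW := traj_eq_evV_iterMV TeData 6 x we0 hWp0 hWp n
  have eUo := traj_eq_evV_iterMV ToData 6 x uo0 hUo0 hUo n
  have eWo := traj_eq_evV_iterMV ToData 6 x wo0 hWo0 hWo n
  have h3 : 3 ≤ n := by omega
  -- boxes and non-increase of the even coordinates from 7 on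
  have bU := even_tail_box hx1 hx2 cert_even_base_u hUp0 hUp
  have bW := even_tail_box hx1 hx2 cert_even_base_w hWp0 hWp
  have rUa : ∀ z : ℕ → ℝ, InBox EBL EBH 10000 6 z → 10000 * mulTV TeData 6 x z 0 ≤ evZ Ua x * z 0 := by
    intro z hz
    have := dotV_nonneg_of_consCheck (by norm_num) (by norm_num) (by norm_num) cert_rate_Ua
      (by simp [selfUpRateCons]) (s4t_h1 hx1) (s4t_h2 hx2) hz (by norm_num)
    rw [dotV_selfUpRateCons TeData (by norm_num : 0 < 6)] at this; push_cast at this; linarith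
  have rUb : ∀ z : ℕ → ℝ, InBox EBL EBH 10000 6 z → 10000 * mulTV TeData 6 x z 1 ≤ evZ Ub x * z 1 := by
    intro z hz
    have := dotV_nonneg_of_consCheck (by norm_num) (by norm_num) (by norm_num) cert_rate_Ub
      (by simp [selfUpRateCons]) (s4t_h1 hx1) (s4t_h2 hx2) hz (by norm_num)
    rw [dotV_selfUpRateCons TeData (by norm_num : 1 < 6)] at this; push_cast at this; linarith
  have hUa1 : evZ Ua x ≤ 10000 := by
    have := evZ_nonneg_on_enclosure (by norm_num) cert_Ua_le hx1 hx2
    rw [evZ_addZ, evZ_smulZ] at this; simp [evZ] at this; linarith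
  have hUb1 : evZ Ub x ≤ 10000 := by
    have := evZ_nonneg_on_enclosure (by norm_num) cert_Ub_le hx1 hx2
    rw [evZ_addZ, evZ_smulZ] at this; simp [evZ] at this; linarith
  have boxE : ∀ z : ℕ → ℝ, InBox EBL EBH 10000 6 z → 0 ≤ z 0 ∧ 0 ≤ z 1 := by
    intro z hz; have h := hz.2 1 (by norm_num); simp [EBL, EBH] at h; exact ⟨hz.1, by nlinarith [hz.1, h.1]⟩
  have mono0 : ∀ U : ℕ → ℕ → ℝ, (∀ t i, i < 6 → U (t + 1) i = mulTV TeData 6 x (U t) i) →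
      (∀ t, 7 ≤ t → InBox EBL EBH 10000 6 (U t)) → ∀ t, 7 ≤ t → U t 0 ≤ U 7 0 ∧ U t 1 ≤ U 7 1 := by
    intro U hU hB t ht
    induction t, ht using Nat.le_induction with
    | base => exact ⟨le_rfl, le_rfl⟩
    | succ t ht ih =>
      obtain ⟨z0, z1⟩ := boxE _ (hB t ht)
      have a0 := rUa _ (hB t ht); have a1 := rUb _ (hB t ht)
      rw [← hU t 0 (by norm_num)] at a0; rw [← hU t 1 (by norm_num)] at a1
      have k0 : evZ Ua x * U t 0 ≤ 10000 * U t 0 := mul_le_mul_of_nonneg_right hUa1 z0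
      have k1 : evZ Ub x * U t 1 ≤ 10000 * U t 1 := mul_le_mul_of_nonneg_right hUb1 z1
      constructor <;> nlinarith [ih.1, ih.2]
  obtain ⟨mU0, mU1⟩ := mono0 Up hUp bU n h7
  obtain ⟨-, mW1⟩ := mono0 Wp hWp bW n h7
  -- the values at 7
  have e70 := traj_eq_evV_iterMV TeData 6 x ue0 hUp0 hUp 7 0 (by norm_num)
  have e71 := traj_eq_evV_iterMV TeData 6 x ue0 hUp0 hUp 7 1 (by norm_num)
  have e7w := traj_eq_evV_iterMV TeData 6 x we0 hWp0 hWp 7 1 (by norm_num)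
  rw [ue7l_eq] at e70 e71; rw [we7l_eq] at e7w
  simp only [evV] at e70 e71 e7w
  -- letters below the even coordinates at n: b, c ≤ Up n 1; d ≤ Up n 0; e, f ≤ Wp n 1 (odd signs)
  obtain ⟨sda, scb, -, sfe⟩ := strip4_odd_signs n hx1 hx2
  have fin := strip4_ne_top n x
  have hda := (ENNReal.toReal_le_toReal (fin _ _) (fin _ _)).2 sda
  have hcb := (ENNReal.toReal_le_toReal (fin _ _) (fin _ _)).2 scb
  have hfe := (ENNReal.toReal_le_toReal (fin _ _) (fin _ _)).2 sfe
  have nb : 0 ≤ (pathKernel (discreteDomainGraph (rectDomain n 3) 1) x (st 0 0) (st n 1)).toReal := ENNReal.toReal_nonneg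
  have nc : 0 ≤ (pathKernel (discreteDomainGraph (rectDomain n 3) 1) x (st 0 0) (st n 2)).toReal := ENNReal.toReal_nonneg
  have nd : 0 ≤ (pathKernel (discreteDomainGraph (rectDomain n 3) 1) x (st 0 0) (st n 3)).toReal := ENNReal.toReal_nonneg
  have ne : 0 ≤ (pathKernel (discreteDomainGraph (rectDomain n 3) 1) x (st 0 1) (st n 1)).toReal := ENNReal.toReal_nonneg
  have nf : 0 ≤ (pathKernel (discreteDomainGraph (rectDomain n 3) 1) x (st 0 1) (st n 2)).toReal := ENNReal.toReal_nonneg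
  have hlb : (pathKernel (discreteDomainGraph (rectDomain n 3) 1) x (st 0 0) (st n 1)).toReal ≤ evZ (ue7l.getD 1 []) x := by linarith
  have hlc : (pathKernel (discreteDomainGraph (rectDomain n 3) 1) x (st 0 0) (st n 2)).toReal ≤ evZ (ue7l.getD 1 []) x := by linarith
  have hld : (pathKernel (discreteDomainGraph (rectDomain n 3) 1) x (st 0 0) (st n 3)).toReal ≤ evZ (ue7l.getD 0 []) x := by
    have : 0 ≤ (pathKernel (discreteDomainGraph (rectDomain n 3) 1) x (st 0 0) (st n 0)).toReal := ENNReal.toReal_nonneg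
    have hUn : Up n 0 = (pathKernel (discreteDomainGraph (rectDomain n 3) 1) x (st 0 0) (st n 0)).toReal + (pathKernel (discreteDomainGraph (rectDomain n 3) 1) x (st 0 0) (st n 3)).toReal := by rw [(hUpd n).1, t30]
    linarith
  have hle : (pathKernel (discreteDomainGraph (rectDomain n 3) 1) x (st 0 1) (st n 1)).toReal ≤ evZ (we7l.getD 1 []) x := by linarith
  have hlf : (pathKernel (discreteDomainGraph (rectDomain n 3) 1) x (st 0 1) (st n 2)).toReal ≤ evZ (we7l.getD 1 []) x := by linarith
  -- table values at S_3 below the end kernels at n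
  have v01 := toReal_end_of_table (m := 3) (j := 0) (k := 1) (by norm_num) hx0 E3_01_eq
  have e01 : 0 ≤ evZ E3_01 x := by rw [← v01]; exact ENNReal.toReal_nonneg
  have h01 : evZ E3_01 x ≤ (pathKernel (discreteDomainGraph (rectDomain n 3) 1) x (st 0 0) (st 0 1)).toReal := by
    rw [← v01]
    exact (ENNReal.toReal_le_toReal (strip4_ne_top 3 x _ _) (strip4_ne_top n x _ _)).2
      (pathKernel_mono (strip4_graph_mono h3) x _ _)
  have v02 := toReal_end_of_table (m := 3) (j := 0) (k := 2) (by norm_num) hx0 E3_02_eq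
  have e02 : 0 ≤ evZ E3_02 x := by rw [← v02]; exact ENNReal.toReal_nonneg
  have h02 : evZ E3_02 x ≤ (pathKernel (discreteDomainGraph (rectDomain n 3) 1) x (st 0 0) (st 0 2)).toReal := by
    rw [← v02]
    exact (ENNReal.toReal_le_toReal (strip4_ne_top 3 x _ _) (strip4_ne_top n x _ _)).2
      (pathKernel_mono (strip4_graph_mono h3) x _ _)
  have v03 := toReal_end_of_table (m := 3) (j := 0) (k := 3) (by norm_num) hx0 E3_03_eq
  have e03 : 0 ≤ evZ E3_03 x := by rw [← v03]; exact ENNReal.toReal_nonneg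
  have h03 : evZ E3_03 x ≤ (pathKernel (discreteDomainGraph (rectDomain n 3) 1) x (st 0 0) (st 0 3)).toReal := by
    rw [← v03]
    exact (ENNReal.toReal_le_toReal (strip4_ne_top 3 x _ _) (strip4_ne_top n x _ _)).2
      (pathKernel_mono (strip4_graph_mono h3) x _ _)
  have v12 := toReal_end_of_table (m := 3) (j := 1) (k := 2) (by norm_num) hx0 E3_12_eq
  have e12 : 0 ≤ evZ E3_12 x := by rw [← v12]; exact ENNReal.toReal_nonneg
  have h12 : evZ E3_12 x ≤ (pathKernel (discreteDomainGraph (rectDomain n 3) 1) x (st 0 1) (st 0 2)).toReal := by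
    rw [← v12]
    exact (ENNReal.toReal_le_toReal (strip4_ne_top 3 x _ _) (strip4_ne_top n x _ _)).2
      (pathKernel_mono (strip4_graph_mono h3) x _ _)
  -- the tail certificates
  obtain ⟨w0, w1, w2, w3, w4, w5, w6, w7, w8, w9, w10, w11, w12⟩ := evZ_endTailPolys x
  have tt0 := evZ_nonneg_on_enclosure (N := 2) (P := endTailPolys.getD 0 []) (by norm_num)
    (by rw [← posOn'_eq]; exact cert_endTail_0) hx1 hx2
  rw [w0] at tt0
  have tt1 := evZ_nonneg_on_enclosure (N := 2) (P := endTailPolys.getD 1 []) (by norm_num)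
    (by rw [← posOn'_eq]; exact cert_endTail_1) hx1 hx2
  rw [w1] at tt1
  have tt2 := evZ_nonneg_on_enclosure (N := 2) (P := endTailPolys.getD 2 []) (by norm_num)
    (by rw [← posOn'_eq]; exact cert_endTail_2) hx1 hx2
  rw [w2] at tt2
  have tt3 := evZ_nonneg_on_enclosure (N := 2) (P := endTailPolys.getD 3 []) (by norm_num)
    (by rw [← posOn'_eq]; exact cert_endTail_3) hx1 hx2
  rw [w3] at tt3
  have tt4 := evZ_nonneg_on_enclosure (N := 2) (P := endTailPolys.getD 4 []) (by norm_num)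
    (by rw [← posOn'_eq]; exact cert_endTail_4) hx1 hx2
  rw [w4] at tt4
  have tt5 := evZ_nonneg_on_enclosure (N := 2) (P := endTailPolys.getD 5 []) (by norm_num)
    (by rw [← posOn'_eq]; exact cert_endTail_5) hx1 hx2
  rw [w5] at tt5
  have tt6 := evZ_nonneg_on_enclosure (N := 2) (P := endTailPolys.getD 6 []) (by norm_num)
    (by rw [← posOn'_eq]; exact cert_endTail_6) hx1 hx2
  rw [w6] at tt6
  have tt7 := evZ_nonneg_on_enclosure (N := 2) (P := endTailPolys.getD 7 []) (by norm_num)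
    (by rw [← posOn'_eq]; exact cert_endTail_7) hx1 hx2
  rw [w7] at tt7
  have tt8 := evZ_nonneg_on_enclosure (N := 2) (P := endTailPolys.getD 8 []) (by norm_num)
    (by rw [← posOn'_eq]; exact cert_endTail_8) hx1 hx2
  rw [w8] at tt8
  have tt9 := evZ_nonneg_on_enclosure (N := 2) (P := endTailPolys.getD 9 []) (by norm_num)
    (by rw [← posOn'_eq]; exact cert_endTail_9) hx1 hx2
  rw [w9] at tt9
  have tt10 := evZ_nonneg_on_enclosure (N := 2) (P := endTailPolys.getD 10 []) (by norm_num)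
    (by rw [← posOn'_eq]; exact cert_endTail_10) hx1 hx2
  rw [w10] at tt10
  have tt11 := evZ_nonneg_on_enclosure (N := 2) (P := endTailPolys.getD 11 []) (by norm_num)
    (by rw [← posOn'_eq]; exact cert_endTail_11) hx1 hx2
  rw [w11] at tt11
  have tt12 := evZ_nonneg_on_enclosure (N := 2) (P := endTailPolys.getD 12 []) (by norm_num)
    (by rw [← posOn'_eq]; exact cert_endTail_12) hx1 hx2
  rw [w12] at tt12
  exact endForms_of_bounds nb nc nd ne nf hlb hlc hld hle hlf e01 e02 e03 e12 h01 h02 h03 h12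
    tt0 tt1 tt2 tt3 tt4 tt5 tt6 tt7 tt8 tt9 tt10 tt11 tt12

/-- **The thirteen END-PAIR forms of the 4-row strips in the letters**, every `n ≥ 1`, every `x ∈ [1/3, 5/13]`:
`ℓ₁ ℓ₂ ≤ E E'` for the classes `(bb|E₀₁E₀₁), (bc|E₀₁E₀₂), (bd|E₀₁E₀₃), (ce|E₀₁E₁₂), (de|E₀₁E₀₂), (df|E₀₁E₀₁), (cc|E₀₂E₀₂),
(cd|E₀₂E₀₃), (cf|E₀₂E₁₂), (df|E₀₂E₀₂), (dd|E₀₃E₀₃), (cc|E₀₃E₁₂), (ff|E₁₂E₁₂)`. [folklore] -/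
theorem strip4_endForms_real (n : ℕ) (hn : 1 ≤ n) {x : ℝ} (hx1 : 1 / 3 ≤ x) (hx2 : x ≤ 5 / 13) :
    (pathKernel (discreteDomainGraph (rectDomain n 3) 1) x (st 0 0) (st n 1)).toReal * (pathKernel (discreteDomainGraph (rectDomain n 3) 1) x (st 0 0) (st n 1)).toReal ≤
      (pathKernel (discreteDomainGraph (rectDomain n 3) 1) x (st 0 0) (st 0 1)).toReal * (pathKernel (discreteDomainGraph (rectDomain n 3) 1) x (st 0 0) (st 0 1)).toReal ∧
    (pathKernel (discreteDomainGraph (rectDomain n 3) 1) x (st 0 0) (st n 1)).toReal * (pathKernel (discreteDomainGraph (rectDomain n 3) 1) x (st 0 0) (st n 2)).toReal ≤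
      (pathKernel (discreteDomainGraph (rectDomain n 3) 1) x (st 0 0) (st 0 1)).toReal * (pathKernel (discreteDomainGraph (rectDomain n 3) 1) x (st 0 0) (st 0 2)).toReal ∧
    (pathKernel (discreteDomainGraph (rectDomain n 3) 1) x (st 0 0) (st n 1)).toReal * (pathKernel (discreteDomainGraph (rectDomain n 3) 1) x (st 0 0) (st n 3)).toReal ≤
      (pathKernel (discreteDomainGraph (rectDomain n 3) 1) x (st 0 0) (st 0 1)).toReal * (pathKernel (discreteDomainGraph (rectDomain n 3) 1) x (st 0 0) (st 0 3)).toReal ∧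
    (pathKernel (discreteDomainGraph (rectDomain n 3) 1) x (st 0 0) (st n 2)).toReal * (pathKernel (discreteDomainGraph (rectDomain n 3) 1) x (st 0 1) (st n 1)).toReal ≤
      (pathKernel (discreteDomainGraph (rectDomain n 3) 1) x (st 0 0) (st 0 1)).toReal * (pathKernel (discreteDomainGraph (rectDomain n 3) 1) x (st 0 1) (st 0 2)).toReal ∧
    (pathKernel (discreteDomainGraph (rectDomain n 3) 1) x (st 0 0) (st n 3)).toReal * (pathKernel (discreteDomainGraph (rectDomain n 3) 1) x (st 0 1) (st n 1)).toReal ≤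
      (pathKernel (discreteDomainGraph (rectDomain n 3) 1) x (st 0 0) (st 0 1)).toReal * (pathKernel (discreteDomainGraph (rectDomain n 3) 1) x (st 0 0) (st 0 2)).toReal ∧
    (pathKernel (discreteDomainGraph (rectDomain n 3) 1) x (st 0 0) (st n 3)).toReal * (pathKernel (discreteDomainGraph (rectDomain n 3) 1) x (st 0 1) (st n 2)).toReal ≤
      (pathKernel (discreteDomainGraph (rectDomain n 3) 1) x (st 0 0) (st 0 1)).toReal * (pathKernel (discreteDomainGraph (rectDomain n 3) 1) x (st 0 0) (st 0 1)).toReal ∧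
    (pathKernel (discreteDomainGraph (rectDomain n 3) 1) x (st 0 0) (st n 2)).toReal * (pathKernel (discreteDomainGraph (rectDomain n 3) 1) x (st 0 0) (st n 2)).toReal ≤
      (pathKernel (discreteDomainGraph (rectDomain n 3) 1) x (st 0 0) (st 0 2)).toReal * (pathKernel (discreteDomainGraph (rectDomain n 3) 1) x (st 0 0) (st 0 2)).toReal ∧
    (pathKernel (discreteDomainGraph (rectDomain n 3) 1) x (st 0 0) (st n 2)).toReal * (pathKernel (discreteDomainGraph (rectDomain n 3) 1) x (st 0 0) (st n 3)).toReal ≤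
      (pathKernel (discreteDomainGraph (rectDomain n 3) 1) x (st 0 0) (st 0 2)).toReal * (pathKernel (discreteDomainGraph (rectDomain n 3) 1) x (st 0 0) (st 0 3)).toReal ∧
    (pathKernel (discreteDomainGraph (rectDomain n 3) 1) x (st 0 0) (st n 2)).toReal * (pathKernel (discreteDomainGraph (rectDomain n 3) 1) x (st 0 1) (st n 2)).toReal ≤
      (pathKernel (discreteDomainGraph (rectDomain n 3) 1) x (st 0 0) (st 0 2)).toReal * (pathKernel (discreteDomainGraph (rectDomain n 3) 1) x (st 0 1) (st 0 2)).toReal ∧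
    (pathKernel (discreteDomainGraph (rectDomain n 3) 1) x (st 0 0) (st n 3)).toReal * (pathKernel (discreteDomainGraph (rectDomain n 3) 1) x (st 0 1) (st n 2)).toReal ≤
      (pathKernel (discreteDomainGraph (rectDomain n 3) 1) x (st 0 0) (st 0 2)).toReal * (pathKernel (discreteDomainGraph (rectDomain n 3) 1) x (st 0 0) (st 0 2)).toReal ∧
    (pathKernel (discreteDomainGraph (rectDomain n 3) 1) x (st 0 0) (st n 3)).toReal * (pathKernel (discreteDomainGraph (rectDomain n 3) 1) x (st 0 0) (st n 3)).toReal ≤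
      (pathKernel (discreteDomainGraph (rectDomain n 3) 1) x (st 0 0) (st 0 3)).toReal * (pathKernel (discreteDomainGraph (rectDomain n 3) 1) x (st 0 0) (st 0 3)).toReal ∧
    (pathKernel (discreteDomainGraph (rectDomain n 3) 1) x (st 0 0) (st n 2)).toReal * (pathKernel (discreteDomainGraph (rectDomain n 3) 1) x (st 0 0) (st n 2)).toReal ≤
      (pathKernel (discreteDomainGraph (rectDomain n 3) 1) x (st 0 0) (st 0 3)).toReal * (pathKernel (discreteDomainGraph (rectDomain n 3) 1) x (st 0 1) (st 0 2)).toReal ∧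
    (pathKernel (discreteDomainGraph (rectDomain n 3) 1) x (st 0 1) (st n 2)).toReal * (pathKernel (discreteDomainGraph (rectDomain n 3) 1) x (st 0 1) (st n 2)).toReal ≤
      (pathKernel (discreteDomainGraph (rectDomain n 3) 1) x (st 0 1) (st 0 2)).toReal * (pathKernel (discreteDomainGraph (rectDomain n 3) 1) x (st 0 1) (st 0 2)).toReal := by
  rcases Nat.lt_or_ge n 7 with h7 | h7
  · rcases Nat.lt_or_ge n 3 with h3 | h3
    · interval_cases n
      · exact strip4_endForms_head1 hx1 hx2
      · exact strip4_endForms_head2 hx1 hx2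
    · exact strip4_endForms_head3 n h3 h7 hx1 hx2
  · exact strip4_endForms_tail n h7 hx1 hx2

/-- The end-pair class `(dd | E₀₃E₀₃)` alone: `Z((0,0),(n,3))² ≤ Z((0,0),(0,3))²` in real parts (registered helper). [folklore] -/
theorem strip4_end_dd (n : ℕ) (hn : 1 ≤ n) {x : ℝ} (hx1 : 1 / 3 ≤ x) (hx2 : x ≤ 5 / 13) :
    (pathKernel (discreteDomainGraph (rectDomain n 3) 1) x (st 0 0) (st n 3)).toReal * (pathKernel (discreteDomainGraph (rectDomain n 3) 1) x (st 0 0) (st n 3)).toReal ≤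
      (pathKernel (discreteDomainGraph (rectDomain n 3) 1) x (st 0 0) (st 0 3)).toReal * (pathKernel (discreteDomainGraph (rectDomain n 3) 1) x (st 0 0) (st 0 3)).toReal :=
  (strip4_endForms_real n hn hx1 hx2).2.2.2.2.2.2.2.2.2.2.1

end Summit.CriticalPhenomena.SAWScalingLimit.Theorems.BoundaryTP2
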